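import Literature.Analysis.ValidatedNumerics.TaylorModelIntegralCertArctan
import Literature.Analysis.ValidatedNumerics.TaylorModelArctanSharp
import HarnessLib

/-!
# Kernel-checkable integral certificates with `arctan` statements — the `(1+c²)`-sharp remainder

Trunk T-ANA (Analysis/ValidatedNumerics); namespace `Literature.Analysis.ValidatedNumerics.PolyMP`.
Sequel of `TaylorModelIntegralCertArctan.lean` (straight-line programs `AProg` with the statements `TOp` + `arctan vᵢ`,
run on an initial stack of interval-enclosed parameters; per-panel Taylor models; the kernel-recomputed panel / full
integral enclosures and their soundness with no side hypotheses but the parameter box) and of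
`TaylorModelArctanSharp.lean` (the Taylor model `tatanTMS` of `arctan ∘ g` whose remainder carries the geometric factor
`(1+c²)^{-⌊K/2⌋}` of the radius of convergence `√(1+c²)` of the expansion at the centre value `c` — the derivative bound
`|arctan⁽ⁿ⁾(x)| ≤ (n−1)!/(1+x²)^{n/2}` of Adegoke–Layeni, Theorem 1 — instead of the uniform `|u|^{K+1}/(K+1)`).

Nothing landed is edited: the program SYNTAX and SEMANTICS (`AOp`, `AProg`, `AOp.evalF`, `AProg.runF`, `AProg.toFunP`)
are those of the previous file, and so is the model of every `base` statement (`TOp.model` / `TOp.tmem_model`); this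
file re-runs the generic program machinery of Melquiond (op. cit., Sect. 3.3) with the ONE change that the statement
`atan i` is modelled by `tatanTMS` (sound by `tmem_atan_of_tatanTMS`) in place of `tatanTM`:

* `AOp.modelS`, **`AOp.tmem_modelS`**, `AProg.modelS`, **`AProg.stackMem_modelS`**, `AProg.pmodelPS`,
  `AProg.tmem_pmodelPS`;
* the certificate `certDataAS`, `certCheckAS`, **`integral_bounds_of_certCheckAS`**:
  `certCheckAS … B … = true → BoxMem ps B → lo ≤ ∫₀^{2nh} P(ps; t) q(t) dt ≤ hi`;
* the SHARDED form `panelCheckAS`, **`fsegOK_of_panelCheckAS`** producing `FSegOK (p.toFunP ps) …` segments — the same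
  certified object as `panelCheckA`, so segments certified by either checker glue by `FSegOK.append`.

Same parameters `S`, `D`, `K`, `Ke`, `ke`, `Kl`, `Kt`, `kt`, `Ka` and the same certificate data as `certCheckA` /
`panelCheckA`; only the acceptance region grows (the scaled remainder `tatanCompRemS S B K c ≤ tatanCompRem S B K`, e.g.
`S = 2^40`, `B = 2^39`, `K = 20`, `c = 1`: `25` against `24967`).  Problem-independent; no facts, no axioms.

## References

* G. Melquiond, *Proving bounds on real-valued functions with computations*, IJCAR 2008, LNCS 5195, 2–17: Sect. 3.3
  (straight-line programs; the generic evaluator over a stack, relative operand positions; unary and binary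
  operations of the grammar). [cite: Melquiond2008, Sect. 3.3]
* A. Mahboubi, G. Melquiond, T. Sibut-Pinote, *Formally verified approximations of definite integrals*, ITP 2016,
  LNCS 9807, 274–289: Sect. 3.2 Lemma 3, Sect. 3.3 (panel enclosures, their sum), Sect. 4.1 (programs on an initial
  stack of constants with interval hypotheses; inclusion theorem (3)). [cite: MahboubiMelquiondSibutpinote2016, Sect. 4.1]
* M. Joldeş, *Rigorous Polynomial Approximations and Applications*, PhD thesis, ENS Lyon (2011): Section 2.2.1 (the
  remainder of the Taylor model of a basic function from bounds on its derivatives), Algorithm 2.2.8 (`TMComp`) and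
  Algorithm 2.2.10 (Taylor models of an expression by structural recursion). [cite: Joldes2011, Algorithm 2.2.10]
* K. Adegoke, O. Layeni, *The higher derivatives of the inverse tangent function and rapidly convergent BBP-type
  formulas for pi*, Appl. Math. E-Notes 10 (2010) 70–75 (arXiv:1603.08540): Theorem 1. [cite: AdegokeLayeni2016, Theorem 1]
-/

open MeasureTheory intervalIntegral Set

namespace Literature.Analysis.ValidatedNumerics

namespace PolyMP

open Literature.Analysis.ValidatedNumerics.NumericsMP
open Literature.Analysis.ValidatedNumerics.ExpPoly (Poly BPoly)
open Literature.Analysis.ValidatedNumerics.ExpPoly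

/-! ### Measurability of the denoted function (module-private in the previous file; re-derived) -/

/-- [folklore] -/
private theorem measurable_evalF_baseS' {fs : List (ℝ → ℝ)} (hfs : ∀ i, Measurable (getReg (fun _ => (0 : ℝ)) fs i)) :
    ∀ op : SOp, Measurable (op.evalF fs)
  | SOp.poly g => (Poly.continuous_eval g).measurable
  | SOp.expAff a b => by
      show Measurable fun t : ℝ => Real.exp ((a : ℝ) + b * t)
      exact Real.measurable_exp.comp (measurable_const.add (measurable_const.mul measurable_id))
  | SOp.neg i => (hfs i).neg
  | SOp.add i j => (hfs i).add (hfs j)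
  | SOp.mul i j => (hfs i).mul (hfs j)
  | SOp.inv i => (hfs i).inv
  | SOp.sqrt i => Real.continuous_sqrt.measurable.comp (hfs i)
  | SOp.log i => Real.measurable_log.comp (hfs i)
  | SOp.exp i => Real.measurable_exp.comp (hfs i)

/-- [folklore] -/
private theorem measurable_evalF_baseT' {fs : List (ℝ → ℝ)} (hfs : ∀ i, Measurable (getReg (fun _ => (0 : ℝ)) fs i)) :
    ∀ op : TOp, Measurable (op.evalF fs)
  | TOp.base op => measurable_evalF_baseS' hfs op
  | TOp.sin i => Real.measurable_sin.comp (hfs i)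
  | TOp.cos i => Real.measurable_cos.comp (hfs i)

/-- [folklore] -/
private theorem measurable_evalF_A' {fs : List (ℝ → ℝ)} (hfs : ∀ i, Measurable (getReg (fun _ => (0 : ℝ)) fs i)) :
    ∀ op : AOp, Measurable (op.evalF fs)
  | AOp.base op => measurable_evalF_baseT' hfs op
  | AOp.atan i => Real.continuous_arctan.measurable.comp (hfs i)

/-- [folklore] -/
private theorem measurable_getReg_cons_A' {f : ℝ → ℝ} {fs : List (ℝ → ℝ)} (hf : Measurable f)
    (hfs : ∀ i, Measurable (getReg (fun _ => (0 : ℝ)) fs i)) :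
    ∀ i, Measurable (getReg (fun _ => (0 : ℝ)) (f :: fs) i)
  | 0 => by simpa using hf
  | i + 1 => by simpa using hfs i

/-- [folklore] -/
private theorem measurable_runF_A' : ∀ (p : AProg) (fs : List (ℝ → ℝ)),
    (∀ i, Measurable (getReg (fun _ => (0 : ℝ)) fs i)) →
      ∀ i, Measurable (getReg (fun _ => (0 : ℝ)) (p.runF fs) i)
  | [], fs, hfs => by simpa [AProg.runF] using hfs
  | op :: p, fs, hfs => by
      rw [AProg.runF]
      exact measurable_runF_A' p _ (measurable_getReg_cons_A' (measurable_evalF_A' hfs op) hfs)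

/-- [folklore] -/
private theorem measurable_constStack_A' : ∀ (ps : List ℝ) (i : ℕ),
    Measurable (getReg (fun _ => (0 : ℝ)) (constStack ps) i)
  | [], i => by rw [constStack, List.map_nil, getReg_nil]; exact measurable_const
  | c :: ps, 0 => by
      simp only [constStack, List.map_cons, getReg_cons_zero]
      exact measurable_const
  | c :: ps, i + 1 => by simpa [constStack] using measurable_constStack_A' ps i

/-- The function denoted by a program with parameters is measurable (junk values of `⁻¹`, `√`, `log` included).
[folklore] -/
private theorem AProg.measurable_toFunP' (p : AProg) (ps : List ℝ) : Measurable (p.toFunP ps) := by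
  unfold AProg.toFunP
  exact measurable_runF_A' p (constStack ps) (measurable_constStack_A' ps) 0

/-! ### The panel Taylor model of a program, sharp `arctan` remainder -/

/-- [folklore] -/
private theorem StackMem.consAS {S : ℕ} {h : ℚ} {c : ℚ} {fs : List (ℝ → ℝ)} {Ws : List IPoly} (f : ℝ → ℝ)
    {W : IPoly} (hf : TMem S h (fun u => f ((c : ℝ) + u)) W) (hst : StackMem S h c fs Ws) :
    StackMem S h c (f :: fs) (W :: Ws) := fun i => by
  cases i with
  | zero => simpa using hf
  | succ i => simpa using hst i

namespace AOp

/-- **The Taylor model pushed by one statement** on the panel `|u| ≤ h` centred at `c`, given the stack `Ws` of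
register models, with the SHARP arctangent remainder: `TOp.model` for a `base` statement (verbatim), `tatanTMS` of
the operand's register model for `atan` (composition `TMComp` around the midpoint `c₀` of the operand's constant
coefficient with the remainder `|u|^{K+1}/((K+1)(1+c₀²)^{⌊K/2⌋})`, the point value `arctan c₀` from `tatanPt S Ka`).
[cite: Joldes2011, Algorithm 2.2.10] -/
def modelS (S : ℕ) (h : ℚ) (D K Ke ke Kl Kt kt Ka : ℕ) (c : ℚ) (Ws : List IPoly) :
    AOp → List (List ℤ × ℕ) → WExpr.MRes
  | base op, cs => op.model S h D K Ke ke Kl Kt kt c Ws cs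
  | atan i, cs =>
      let t := tatanTMS S h D K Ka (getReg [] Ws i)
      ⟨t.1, cs, t.2⟩

/-- **Soundness of `AOp.modelS`** under the stack invariant. [cite: Joldes2011, Algorithm 2.2.10] -/
theorem tmem_modelS {S : ℕ} (hS : 0 < S) {h : ℚ} (h0 : 0 ≤ h) {D K Ke ke Kl Kt kt Ka : ℕ} (c : ℚ)
    {fs : List (ℝ → ℝ)} {Ws : List IPoly} (hst : StackMem S h c fs Ws) :
    ∀ (op : AOp) (cs : List (List ℤ × ℕ)), (op.modelS S h D K Ke ke Kl Kt kt Ka c Ws cs).ok = true →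
      TMem S h (fun u => op.evalF fs ((c : ℝ) + u)) (op.modelS S h D K Ke ke Kl Kt kt Ka c Ws cs).P
  | base op, cs, hok => TOp.tmem_model hS h0 c hst op cs hok
  | atan i, cs, hok => by
      simp only [modelS] at hok ⊢
      exact tmem_atan_of_tatanTMS hS h0 (hst i) hok

/-- The sharp statement model accepts whenever the plain one does, with the same polynomial part up to the remainder
interval: both flags are the definedness of the point value `tatanPt S Ka c₀`. [cite: Joldes2011, Algorithm 2.2.8] -/
theorem modelS_ok_eq_model_ok (S : ℕ) (h : ℚ) (D K Ke ke Kl Kt kt Ka : ℕ) (c : ℚ) (Ws : List IPoly) :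
    ∀ (op : AOp) (cs : List (List ℤ × ℕ)),
      (op.modelS S h D K Ke ke Kl Kt kt Ka c Ws cs).ok = (op.model S h D K Ke ke Kl Kt kt Ka c Ws cs).ok
  | base op, cs => rfl
  | atan i, cs => by
      simp only [modelS, model, tatanTMS, tatanTM]
      cases tatanPt S Ka (mid0 S (getReg [] Ws i)) <;> rfl

end AOp

namespace AProg

/-- **The register models after running a program** on the panel centred at `c` from the stack `Ws`, sharp
arctangent remainder, with the conjunctive acceptance flag (candidates consumed in program order).
[cite: Melquiond2008, Sect. 3.3] -/
def modelS (S : ℕ) (h : ℚ) (D K Ke ke Kl Kt kt Ka : ℕ) (c : ℚ) :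
    AProg → List IPoly → List (List ℤ × ℕ) → List IPoly × Bool
  | [], Ws, _ => (Ws, true)
  | op :: p, Ws, cs =>
      let r := op.modelS S h D K Ke ke Kl Kt kt Ka c Ws cs
      let s := modelS S h D K Ke ke Kl Kt kt Ka c p (r.P :: Ws) r.rest
      (s.1, r.ok && s.2)

/-- **Soundness of `AProg.modelS`**: the stack invariant is preserved by an accepted run.
[cite: Melquiond2008, Sect. 3.3] -/
theorem stackMem_modelS {S : ℕ} (hS : 0 < S) {h : ℚ} (h0 : 0 ≤ h) {D K Ke ke Kl Kt kt Ka : ℕ} (c : ℚ) :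
    ∀ (p : AProg) {fs : List (ℝ → ℝ)} {Ws : List IPoly}, StackMem S h c fs Ws →
      ∀ cs : List (List ℤ × ℕ), (p.modelS S h D K Ke ke Kl Kt kt Ka c Ws cs).2 = true →
        StackMem S h c (p.runF fs) (p.modelS S h D K Ke ke Kl Kt kt Ka c Ws cs).1
  | [], _, _, hst, cs, _ => by simpa [modelS, runF] using hst
  | op :: p, fs, Ws, hst, cs, hok => by
      simp only [modelS, Bool.and_eq_true] at hok
      rw [runF, modelS]
      exact stackMem_modelS hS h0 c p
        (hst.consAS (op.evalF fs) (AOp.tmem_modelS hS h0 c hst op cs hok.1 (D := D) (K := K) (Ke := Ke)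
          (ke := ke) (Kl := Kl) (Kt := Kt) (kt := kt) (Ka := Ka))) _ hok.2

/-- **The panel Taylor model of `u ↦ P(ps; c + u)`**, sharp arctangent remainder: the top register model after the
run on the initial stack of constant models of the parameter box, with its acceptance flag.
[cite: MahboubiMelquiondSibutpinote2016, Sect. 4.1] -/
def pmodelPS (S : ℕ) (h : ℚ) (D K Ke ke Kl Kt kt Ka : ℕ) (c : ℚ) (p : AProg) (B : PBox)
    (cs : List (List ℤ × ℕ)) : IPoly × Bool :=
  let s := p.modelS S h D K Ke ke Kl Kt kt Ka c (constModels S B) cs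
  (getReg [] s.1 0, s.2)

/-- **Soundness of `pmodelPS`**: for every parameter vector of the box, an accepted model encloses `u ↦ P(ps; c + u)`
on `|u| ≤ h`. [cite: MahboubiMelquiondSibutpinote2016, Sect. 4.1] -/
theorem tmem_pmodelPS {S : ℕ} (hS : 0 < S) {h : ℚ} (h0 : 0 ≤ h) {D K Ke ke Kl Kt kt Ka : ℕ} (c : ℚ) (p : AProg)
    {ps : List ℝ} {B : PBox} (hB : BoxMem ps B) (cs : List (List ℤ × ℕ))
    (hok : (p.pmodelPS S h D K Ke ke Kl Kt kt Ka c B cs).2 = true) :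
    TMem S h (fun u => p.toFunP ps ((c : ℝ) + u)) (p.pmodelPS S h D K Ke ke Kl Kt kt Ka c B cs).1 := by
  unfold pmodelPS at hok ⊢
  unfold toFunP
  exact stackMem_modelS hS h0 c p (stackMem_const S h c hB) cs hok 0

end AProg

/-! ### The certificate -/

/-- The panel data `(W_j, pw_j)` of panels `j₀, j₀+1, …` (sharp arctangent remainder) with its conjunctive acceptance
flag; one candidate list per panel. [folklore] -/
def certDataAS (S : ℕ) (h : ℚ) (D K Ke ke Kl Kt kt Ka : ℕ) (p : AProg) (B : PBox) :
    List (List (List ℤ × ℕ)) → ℕ → List (IPoly × Poly) × Bool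
  | [], _ => ([], true)
  | cs :: css, j =>
      let r := p.pmodelPS S h D K Ke ke Kl Kt kt Ka (panelCentre h j) B cs
      let t := certDataAS S h D K Ke ke Kl Kt kt Ka p B css (j + 1)
      ((r.1, midPoly S r.1) :: t.1, r.2 && t.2)

/-- [folklore] -/
private theorem length_certDataAS (S : ℕ) (h : ℚ) (D K Ke ke Kl Kt kt Ka : ℕ) (p : AProg) (B : PBox) :
    ∀ (css : List (List (List ℤ × ℕ))) (j : ℕ),
      (certDataAS S h D K Ke ke Kl Kt kt Ka p B css j).1.length = css.length
  | [], _ => rfl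
  | _ :: css, j => by simp [certDataAS, length_certDataAS S h D K Ke ke Kl Kt kt Ka p B css (j + 1)]

/-- [folklore] -/
private theorem tmem_certDataAS {S : ℕ} (hS : 0 < S) {h : ℚ} (h0 : 0 ≤ h) {D K Ke ke Kl Kt kt Ka : ℕ} (p : AProg)
    {ps : List ℝ} {B : PBox} (hB : BoxMem ps B) :
    ∀ (css : List (List (List ℤ × ℕ))) (j₀ : ℕ), (certDataAS S h D K Ke ke Kl Kt kt Ka p B css j₀).2 = true →
      ∀ i : Fin (certDataAS S h D K Ke ke Kl Kt kt Ka p B css j₀).1.length,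
        TMem S h (fun u => p.toFunP ps ((panelCentre h (j₀ + (i : ℕ)) : ℝ) + u))
          ((certDataAS S h D K Ke ke Kl Kt kt Ka p B css j₀).1.get i).1
  | [], _, _, i => i.elim0
  | cs :: css, j₀, hok, ⟨0, _⟩ => by
      simp only [certDataAS, Bool.and_eq_true] at hok
      simpa [certDataAS] using AProg.tmem_pmodelPS hS h0 (panelCentre h j₀) p hB cs hok.1
  | cs :: css, j₀, hok, ⟨i + 1, hi⟩ => by
      simp only [certDataAS, Bool.and_eq_true] at hok
      have hi' : i < (certDataAS S h D K Ke ke Kl Kt kt Ka p B css (j₀ + 1)).1.length := by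
        simpa [certDataAS] using hi
      have ih := tmem_certDataAS hS h0 p hB css (j₀ + 1) hok.2 ⟨i, hi'⟩
      have e : j₀ + 1 + i = j₀ + (i + 1) := by omega
      simpa [certDataAS, e] using ih

/-- **The certificate** (sharp arctangent remainder) for `lo ≤ ∫₀^{2nh} P(ps; t) q(t) dt ≤ hi` (`n = css.length`),
uniformly over the parameter box `B`: positivity of `S` and `h`, every panel model accepted, and the kernel enclosure
inside `[lo·S, hi·S]`. [folklore] -/
def certCheckAS (S : ℕ) (h : ℚ) (D K Ke ke Kl Kt kt Ka : ℕ) (p : AProg) (B : PBox) (q : Poly)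
    (css : List (List (List ℤ × ℕ))) (lo hi : ℚ) : Bool :=
  let d := certDataAS S h D K Ke ke Kl Kt kt Ka p B css 0
  let I := fullPanelsI S h q d.1 0
  decide (0 < S) && decide (0 < h) && d.2 && decide (lo * S ≤ (I.lo : ℚ)) && decide ((I.hi : ℚ) ≤ hi * S)

/-- **Soundness of the certificate**: the piecewise polynomial integral enclosure re-computed by the kernel from
untrusted data bounds the integral for EVERY parameter vector of the box — the only hypothesis is the box membership
of the parameters. [cite: MahboubiMelquiondSibutpinote2016, Sect. 4.1] -/
theorem integral_bounds_of_certCheckAS {S : ℕ} {h : ℚ} {D K Ke ke Kl Kt kt Ka : ℕ} {p : AProg} {B : PBox} {q : Poly}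
    {css : List (List (List ℤ × ℕ))} {lo hi : ℚ}
    (hc : certCheckAS S h D K Ke ke Kl Kt kt Ka p B q css lo hi = true) {ps : List ℝ} (hB : BoxMem ps B) :
    (lo : ℝ) ≤ ∫ t in (0 : ℝ)..(2 * css.length * (h : ℝ)), p.toFunP ps t * Poly.eval q t ∧
      ∫ t in (0 : ℝ)..(2 * css.length * (h : ℝ)), p.toFunP ps t * Poly.eval q t ≤ (hi : ℝ) := by
  unfold certCheckAS at hc
  simp only [Bool.and_eq_true, decide_eq_true_eq] at hc
  obtain ⟨⟨⟨⟨hS, h0⟩, hok⟩, hlo⟩, hhi⟩ := hc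
  have hD := tmem_certDataAS hS h0.le p hB css 0 hok (D := D) (K := K) (Ke := Ke) (ke := ke) (Kl := Kl)
    (Kt := Kt) (kt := kt) (Ka := Ka)
  simp only [Nat.zero_add] at hD
  obtain ⟨hm, -⟩ := mem_fullPanelsI_of_tmem hS h0.le (AProg.measurable_toFunP' p ps) q
    (certDataAS S h D K Ke ke Kl Kt kt Ka p B css 0).1 0 (fun i => by simpa using hD i)
  rw [length_certDataAS] at hm
  have e1 : (2 * ((0 : ℕ) : ℝ) * (h : ℝ)) = 0 := by simp
  have e2 : (2 * (((0 : ℕ) : ℝ) + (css.length : ℕ)) * (h : ℝ)) = 2 * css.length * (h : ℝ) := by simp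
  rw [e1, e2] at hm
  obtain ⟨h1, h2⟩ := hm
  have hSr : (0 : ℝ) < S := by exact_mod_cast hS
  have hloR : (lo : ℝ) * S ≤ ((fullPanelsI S h q (certDataAS S h D K Ke ke Kl Kt kt Ka p B css 0).1 0).lo : ℝ) := by
    exact_mod_cast hlo
  have hhiR : ((fullPanelsI S h q (certDataAS S h D K Ke ke Kl Kt kt Ka p B css 0).1 0).hi : ℝ) ≤ (hi : ℝ) * S := by
    exact_mod_cast hhi
  exact ⟨le_of_mul_le_mul_right (hloR.trans h1) hSr, le_of_mul_le_mul_right (h2.trans hhiR) hSr⟩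

/-! ### Sharded certificates

One kernel check per panel; the certified object is the function segment `FSegOK (p.toFunP ps) q S a b lo hi` of
`TaylorModelIntegralCertSLP.lean` — the same as `panelCheckA`'s — so the gluing (`FSegOK.append`) and the final
bounds (`FSegOK.bounds`) are literally those, and segments certified with either remainder glue with each other. -/

/-- **The per-panel certificate** (sharp arctangent remainder) for a program with parameters: positivity of `S` and
`h`, the panel model accepted, and the kernel's panel enclosure inside `[plo, phi]`. [folklore] -/
def panelCheckAS (S : ℕ) (h : ℚ) (D K Ke ke Kl Kt kt Ka : ℕ) (p : AProg) (B : PBox) (q : Poly) (j : ℕ)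
    (cs : List (List ℤ × ℕ)) (plo phi : ℤ) : Bool :=
  let r := p.pmodelPS S h D K Ke ke Kl Kt kt Ka (panelCentre h j) B cs
  let I := panelIntegI S h r.1 (midPoly S r.1) (recenter q h j)
  decide (0 < S) && decide (0 < h) && r.2 && decide (plo ≤ I.lo) && decide (I.hi ≤ phi)

/-- **Soundness of the per-panel certificate**, for every parameter vector of the box.
[cite: MahboubiMelquiondSibutpinote2016, Sect. 3.2 Lemma 3, Sect. 4.1] -/
theorem fsegOK_of_panelCheckAS {S : ℕ} {h : ℚ} {D K Ke ke Kl Kt kt Ka : ℕ} {p : AProg} {B : PBox} {q : Poly}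
    {j : ℕ} {cs : List (List ℤ × ℕ)} {plo phi : ℤ}
    (hc : panelCheckAS S h D K Ke ke Kl Kt kt Ka p B q j cs plo phi = true) {ps : List ℝ} (hB : BoxMem ps B) :
    FSegOK (p.toFunP ps) q S (panelLeft h j) (panelLeft h (j + 1)) plo phi := by
  unfold panelCheckAS at hc
  simp only [Bool.and_eq_true, decide_eq_true_eq] at hc
  obtain ⟨⟨⟨⟨hS, h0⟩, hok⟩, hlo⟩, hhi⟩ := hc
  exact fsegOK_of_tmem hS h0 (AProg.measurable_toFunP' p ps) q j
    (AProg.tmem_pmodelPS hS h0.le (panelCentre h j) p hB cs hok) hlo hhi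

end PolyMP

end Literature.Analysis.ValidatedNumerics
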